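import Summits.NavierStokesRegularity.NavierStokesRegularity.Theorems.HodographBetchovSlowClassProductionSliceBound
import Literature.Analysis.Calculus.AreaFormulaMultiplicity

/-!
# `SlowClassProduction` (stmt-NavierStokesRegularity-15831) — the Jacobian-volume transfer: tame hodograph + fold-collar budget ⇒ crux

Route `HodographBetchov`, crux 2.  The singular-germ residue of the crux (line `near_field`,
`slowClassProduction_of_singularSliceBound`) asks, at each singular `l`-slow-accumulating point
`(x₀, T)` of a maximal solution, for per-slice bounds `∫_{‖u(s,·)‖ ≤ l, B(x₀,ρ)} |P(s,·)| ≤ g(s)`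
with `g ∈ L¹(T − ρ, T)`, `P = ⟪ω, ∇u ω⟫`.  The crux idea `jacobian-volume-multiplicity`
(`Cruxes/SlowClassProduction/Ideas/jacobian-volume-multiplicity.md`) proposes to pay these slices in
VELOCITY space: by the area formula with multiplicity the slow class has Jacobian volume
`∫_{Ω ∩ {‖u‖ ≤ l}} |det ∇u| = ∫_{‖v‖ ≤ l} #(u⁻¹{v} ∩ Ω) dv ≤ N · |B̄_l|` whatever the size of
`∇u`, so wherever the production is shape-dominated by the Jacobian (`|P| ≤ K |det ∇u|`, the TAME
part) it costs `≤ K · N · |B̄_l|` per slice, and only the complementary FOLD zone (a neighbourhood of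
the critical surfaces `det ∇u = 0` inside the slow class) has to be budgeted directly.  This file
proves that transfer, sorry-free:

* `lintegral_abs_det_fderiv_slow_le` — SLOW JACOBIAN VOLUME: for `u ∈ C¹(ℝ³, ℝ³)`, a measurable
  `Ω` on which `det ∇u ≠ 0`, and a level `l`, if every slow value `‖v‖ ≤ l` has at most `N`
  preimages in `Ω` then `∫⁻_{Ω ∩ {‖u‖ ≤ l}} |det ∇u| ≤ N · vol(B̄(0,l))` (tree area formula
  `lintegral_abs_det_fderiv_mul_eq_lintegral_encard_mul` with weight `1_{B̄_l}`, local injectivity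
  from the inverse function theorem);
* `sliceBound_of_tame_of_fold` — the per-slice bound: `∫_{‖u‖ ≤ l, B(x₀,ρ)} |P| ≤ K·N·|B̄_l| + φ`
  when the tame regular slow points of the ball cover each slow value at most `N` times and the
  fold part `{‖u‖ ≤ l, dist < ρ, K|det ∇u| < |P|}` carries `∫ |P| ≤ φ`;
* `slowClassProduction_of_tameHodograph` — the crux from TameHodograph (`K·N ∈ L¹(T − ρ, T)`) and
  FoldCollarBudget (`φ ∈ L¹(T − ρ, T)`) at the singular slow-accumulating points of maximal
  solutions (plugged into `slowClassProduction_of_singularSliceBound`).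

Both hypotheses are rate-free: `N` (covering multiplicity of the hodograph over slow values) and
`K` (production-to-Jacobian shape ratio) are dimensionless and invariant under the Navier–Stokes
scaling; nothing here bounds them along the flow — that is the honest residue recorded on the card.
-/

noncomputable section

-- the summit and its single problem share the name `NavierStokesRegularity` (D-0017 nested layout)
set_option linter.dupNamespace false

namespace Summit.NavierStokesRegularity.NavierStokesRegularity.Theorems.SlowClassProduction.NearField

open Set MeasureTheory Function Metric Filter Topology Literature.Analysis.FluidPDE
open scoped ENNReal NNReal ContDiff RealInnerProductSpace

/-! ## Slow Jacobian volume (area formula with multiplicity) -/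

/-- **Slow Jacobian volume.**  Let `u : ℝ³ → ℝ³` be `C¹`, `Ω` a measurable set at every point of
which `det ∇u ≠ 0`, and `l` a level such that every slow value `v`, `‖v‖ ≤ l`, has at most `N`
preimages in `Ω`.  Then `∫⁻_{Ω ∩ {‖u‖ ≤ l}} |det ∇u| ≤ N · vol(B̄(0, l))`: by the area formula with
multiplicity (weight `1_{B̄(0,l)}` on values; local injectivity on `Ω` by the inverse function
theorem) the left side is `∫_{‖v‖ ≤ l} #(u⁻¹{v} ∩ Ω) dv`.  (Lemma `SlowJacobianVolume` of the crux
idea `jacobian-volume-multiplicity`, for measurable rather than open `Ω`.)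
[cite: EvansGariepy2015, Thm. 3.8 (PDF p. 76)] -/
theorem lintegral_abs_det_fderiv_slow_le
    {u : EuclideanSpace ℝ (Fin 3) → EuclideanSpace ℝ (Fin 3)} (hu : ContDiff ℝ 1 u)
    {Ω : Set (EuclideanSpace ℝ (Fin 3))} (hΩ : MeasurableSet Ω)
    (hdet : ∀ x ∈ Ω, (fderiv ℝ u x).det ≠ 0) {l : ℝ} {N : ℝ≥0∞}
    (hN : ∀ v : EuclideanSpace ℝ (Fin 3), ‖v‖ ≤ l → ((u ⁻¹' {v} ∩ Ω).encard : ℝ≥0∞) ≤ N) :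
    ∫⁻ x in Ω ∩ {x | ‖u x‖ ≤ l}, ENNReal.ofReal |(fderiv ℝ u x).det| ≤
      N * volume (closedBall (0 : EuclideanSpace ℝ (Fin 3)) l) := by
  have hstrict : ∀ x, HasStrictFDerivAt u (fderiv ℝ u x) x := fun x =>
    hu.contDiffAt.hasStrictFDerivAt one_ne_zero
  -- local injectivity on `Ω` (inverse function theorem)
  have hinj : ∀ x ∈ Ω, ∃ U ∈ 𝓝[Ω] x, InjOn u U := by
    intro x hx
    have h : HasStrictFDerivAt u
        (((fderiv ℝ u x).toContinuousLinearEquivOfDetNeZero (hdet x hx) :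
          EuclideanSpace ℝ (Fin 3) ≃L[ℝ] EuclideanSpace ℝ (Fin 3)) :
          EuclideanSpace ℝ (Fin 3) →L[ℝ] EuclideanSpace ℝ (Fin 3)) x := by
      simpa using hstrict x
    obtain ⟨U, hU, hUinj⟩ := Literature.Analysis.Calculus.exists_injOn_nhds_of_hasStrictFDerivAt h
    exact ⟨U, mem_nhdsWithin_of_mem_nhds hU, hUinj⟩
  set L : Set (EuclideanSpace ℝ (Fin 3)) := closedBall 0 l with hL_def
  have hLm : MeasurableSet L := measurableSet_closedBall
  have harea := Literature.Analysis.Calculus.lintegral_abs_det_fderiv_mul_eq_lintegral_encard_mul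
    (volume : Measure (EuclideanSpace ℝ (Fin 3))) hΩ
    (fun x hx => (hstrict x).hasFDerivAt.hasFDerivWithinAt) hinj
    (g := L.indicator 1) (measurable_one.indicator hLm)
  -- the slow sublevel set is measurable
  have hSm : MeasurableSet {x : EuclideanSpace ℝ (Fin 3) | ‖u x‖ ≤ l} :=
    measurableSet_le hu.continuous.norm.measurable measurable_const
  calc ∫⁻ x in Ω ∩ {x | ‖u x‖ ≤ l}, ENNReal.ofReal |(fderiv ℝ u x).det|
      = ∫⁻ x in Ω, {x : EuclideanSpace ℝ (Fin 3) | ‖u x‖ ≤ l}.indicator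
          (fun x => ENNReal.ofReal |(fderiv ℝ u x).det|) x := by
        rw [lintegral_indicator hSm, Measure.restrict_restrict hSm, inter_comm]
    _ = ∫⁻ x in Ω, ENNReal.ofReal |(fderiv ℝ u x).det| * L.indicator 1 (u x) := by
        refine lintegral_congr fun x => ?_
        by_cases hx : ‖u x‖ ≤ l
        · have hxL : u x ∈ L := by rw [hL_def, mem_closedBall_zero_iff]; exact hx
          rw [indicator_of_mem (show x ∈ {x : EuclideanSpace ℝ (Fin 3) | ‖u x‖ ≤ l} from hx),
            indicator_of_mem hxL, Pi.one_apply, mul_one]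
        · have hxL : u x ∉ L := by rw [hL_def, mem_closedBall_zero_iff]; exact hx
          rw [indicator_of_notMem (show x ∉ {x : EuclideanSpace ℝ (Fin 3) | ‖u x‖ ≤ l} from hx),
            indicator_of_notMem hxL, mul_zero]
    _ = ∫⁻ y, ((u ⁻¹' {y} ∩ Ω).encard : ℝ≥0∞) * L.indicator 1 y := harea
    _ ≤ ∫⁻ y, L.indicator (fun _ => N) y := by
        refine lintegral_mono fun y => ?_
        by_cases hy : y ∈ L
        · rw [indicator_of_mem hy, indicator_of_mem hy, Pi.one_apply, mul_one]
          exact hN y (by rw [hL_def, mem_closedBall_zero_iff] at hy; exact hy)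
        · rw [indicator_of_notMem hy, indicator_of_notMem hy, mul_zero]
    _ = N * volume L := by
        rw [lintegral_indicator hLm, setLIntegral_const]

/-! ## The per-slice bound: tame part by Jacobian volume, fold part by hypothesis -/

/-- **Per-slice bound from a tame hodograph and a fold budget.**  Let `u : ℝ³ → ℝ³` be `C¹`,
`P = ⟪curl u, ∇u (curl u)⟫` its enstrophy-production density, `x₀` a centre, `ρ` a radius, `l` a
level, `K, N ≥ 0` and `φ` reals.  Suppose (TAME MULTIPLICITY) every slow value `‖v‖ ≤ l` has at most
`N` preimages among the tame regular points of the ball,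
`{dist x x₀ < ρ, det ∇u(x) ≠ 0, |P(x)| ≤ K |det ∇u(x)|}`, and (FOLD BUDGET) the fold part of the
slow ball `{‖u‖ ≤ l, dist x x₀ < ρ, K |det ∇u| < |P|}` carries `∫ |P| ≤ φ`.  Then `P` is
integrable on the slow ball `{‖u‖ ≤ l, dist x x₀ < ρ}` with `∫ |P| ≤ K · N · vol(B̄(0,l)) + φ`.
Proof: split the slow ball into its tame and fold parts; on the tame part `|P| ≤ K |det ∇u|`,
the points with `det ∇u = 0` contribute nothing, and the rest is the slow Jacobian volume
(`lintegral_abs_det_fderiv_slow_le`). [cite: EvansGariepy2015, Thm. 3.8 (PDF p. 76)] -/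
theorem sliceBound_of_tame_of_fold
    {u : EuclideanSpace ℝ (Fin 3) → EuclideanSpace ℝ (Fin 3)} (hu : ContDiff ℝ 1 u)
    {x₀ : EuclideanSpace ℝ (Fin 3)} {ρ l K N φ : ℝ} (hK : 0 ≤ K) (hN : 0 ≤ N)
    (hmult : ∀ v : EuclideanSpace ℝ (Fin 3), ‖v‖ ≤ l →
      ((u ⁻¹' {v} ∩ {x : EuclideanSpace ℝ (Fin 3) | dist x x₀ < ρ ∧ (fderiv ℝ u x).det ≠ 0 ∧
        |inner ℝ (Literature.Analysis.FluidPDE.curl u x) (fderiv ℝ u x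
          (Literature.Analysis.FluidPDE.curl u x))| ≤ K * |(fderiv ℝ u x).det|}).encard : ℝ≥0∞) ≤
        ENNReal.ofReal N)
    (hfold : ∫ x in {x : EuclideanSpace ℝ (Fin 3) | ‖u x‖ ≤ l ∧ dist x x₀ < ρ ∧
        K * |(fderiv ℝ u x).det| < |inner ℝ (Literature.Analysis.FluidPDE.curl u x)
          (fderiv ℝ u x (Literature.Analysis.FluidPDE.curl u x))|},
      |inner ℝ (Literature.Analysis.FluidPDE.curl u x)
        (fderiv ℝ u x (Literature.Analysis.FluidPDE.curl u x))| ≤ φ) :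
    MeasureTheory.IntegrableOn
        (fun x : EuclideanSpace ℝ (Fin 3) =>
          inner ℝ (Literature.Analysis.FluidPDE.curl u x)
            (fderiv ℝ u x (Literature.Analysis.FluidPDE.curl u x)))
        {x : EuclideanSpace ℝ (Fin 3) | ‖u x‖ ≤ l ∧ dist x x₀ < ρ} ∧
      ∫ x in {x : EuclideanSpace ℝ (Fin 3) | ‖u x‖ ≤ l ∧ dist x x₀ < ρ},
        |inner ℝ (Literature.Analysis.FluidPDE.curl u x)
          (fderiv ℝ u x (Literature.Analysis.FluidPDE.curl u x))| ≤
        K * N * (volume (closedBall (0 : EuclideanSpace ℝ (Fin 3)) l)).toReal + φ := by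
  -- ### notation and continuity
  set J : EuclideanSpace ℝ (Fin 3) → ℝ := fun x => (fderiv ℝ u x).det with hJ_def
  set P : EuclideanSpace ℝ (Fin 3) → ℝ :=
    fun x => inner ℝ (curl u x) (fderiv ℝ u x (curl u x)) with hP_def
  have hDcont : Continuous fun x => fderiv ℝ u x := hu.continuous_fderiv one_ne_zero
  have hJcont : Continuous J := ContinuousLinearMap.continuous_det.comp hDcont
  have hωcont : Continuous fun x => curl u x := by
    have : (fun x => curl u x) = fun x => curlCLM (fderiv ℝ u x) := funext fun x => curl_eq_curlCLM u x
    rw [this]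
    exact curlCLM.continuous.comp hDcont
  have hPcont : Continuous P := hωcont.inner (hDcont.clm_apply hωcont)
  have hJm : Measurable J := hJcont.measurable
  have hPm : Measurable P := hPcont.measurable
  -- ### the sets
  set B : Set (EuclideanSpace ℝ (Fin 3)) := {x | ‖u x‖ ≤ l ∧ dist x x₀ < ρ} with hB_def
  set tame : Set (EuclideanSpace ℝ (Fin 3)) := {x | |P x| ≤ K * |J x|} with htame_def
  set reg : Set (EuclideanSpace ℝ (Fin 3)) := {x | J x ≠ 0} with hreg_def
  set Ω : Set (EuclideanSpace ℝ (Fin 3)) := {x | dist x x₀ < ρ ∧ J x ≠ 0 ∧ |P x| ≤ K * |J x|}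
    with hΩ_def
  have hBm : MeasurableSet B :=
    (measurableSet_le hu.continuous.norm.measurable measurable_const).inter
      (measurableSet_lt (continuous_id.dist continuous_const).measurable measurable_const)
  have htamem : MeasurableSet tame := measurableSet_le hPm.abs (measurable_const.mul hJm.abs)
  have hregm : MeasurableSet reg := (hJm (measurableSet_singleton 0)).compl
  have hΩm : MeasurableSet Ω :=
    (measurableSet_lt (continuous_id.dist continuous_const).measurable measurable_const).inter
      (hregm.inter htamem)
  have hBsub : B ⊆ closedBall x₀ ρ := fun x hx => mem_closedBall.2 (le_of_lt hx.2)
  -- ### integrability on the (bounded) slow ball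
  have hPint : IntegrableOn P B :=
    ((hPcont.continuousOn).integrableOn_compact (isCompact_closedBall x₀ ρ)).mono_set hBsub
  have hJint : IntegrableOn (fun x => K * |J x|) B :=
    (((continuous_const.mul hJcont.abs).continuousOn).integrableOn_compact
      (isCompact_closedBall x₀ ρ)).mono_set hBsub
  have hPabs : IntegrableOn (fun x => |P x|) B := hPint.abs
  refine ⟨hPint, ?_⟩
  -- ### split into tame and fold parts
  have hsplit := integral_inter_add_sdiff htamem hPabs
  have hfold_eq : B \ tame = {x : EuclideanSpace ℝ (Fin 3) | ‖u x‖ ≤ l ∧ dist x x₀ < ρ ∧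
      K * |J x| < |P x|} := by
    ext x
    simp only [hB_def, htame_def, Set.mem_sdiff, mem_setOf_eq, not_le, and_assoc]
  -- ### the tame part
  have htame_le : ∫ x in B ∩ tame, |P x| ≤ K * N * (volume (closedBall (0 : EuclideanSpace ℝ (Fin 3)) l)).toReal := by
    have h1 : ∫ x in B ∩ tame, |P x| ≤ ∫ x in B ∩ tame, K * |J x| := by
      refine setIntegral_mono_on (hPabs.mono_set inter_subset_left)
        (hJint.mono_set inter_subset_left) (hBm.inter htamem) fun x hx => hx.2
    have h2 : ∫ x in B ∩ tame, K * |J x| = K * ∫ x in B ∩ tame, |J x| := integral_const_mul _ _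
    -- points with `det ∇u = 0` contribute nothing
    have h3 : ∫ x in B ∩ tame, |J x| = ∫ x in (B ∩ tame) ∩ reg, |J x| := by
      have hJi : IntegrableOn (fun x => |J x|) (B ∩ tame) :=
        (((hJcont.abs).continuousOn).integrableOn_compact (isCompact_closedBall x₀ ρ)).mono_set
          (inter_subset_left.trans hBsub)
      rw [← integral_inter_add_sdiff hregm hJi]
      have h0 : ∫ x in (B ∩ tame) \ reg, |J x| = 0 := by
        refine setIntegral_eq_zero_of_forall_eq_zero fun x hx => ?_
        have hx0 : J x = 0 := not_ne_iff.mp hx.2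
        rw [hx0, abs_zero]
      rw [h0, add_zero]
    -- the rest is the slow Jacobian volume of `Ω`
    have h4 : (B ∩ tame) ∩ reg = Ω ∩ {x | ‖u x‖ ≤ l} := by
      ext x
      simp only [hB_def, htame_def, hreg_def, hΩ_def, mem_inter_iff, mem_setOf_eq]
      tauto
    have h5 : ∫ x in Ω ∩ {x | ‖u x‖ ≤ l}, |J x| ≤
        N * (volume (closedBall (0 : EuclideanSpace ℝ (Fin 3)) l)).toReal := by
      have hΩdet : ∀ x ∈ Ω, (fderiv ℝ u x).det ≠ 0 := fun x hx => hx.2.1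
      have hmult' : ∀ v : EuclideanSpace ℝ (Fin 3), ‖v‖ ≤ l →
          ((u ⁻¹' {v} ∩ Ω).encard : ℝ≥0∞) ≤ ENNReal.ofReal N := fun v hv => hmult v hv
      have hvol := lintegral_abs_det_fderiv_slow_le hu hΩm hΩdet hmult'
      have hfin : ENNReal.ofReal N * volume (closedBall (0 : EuclideanSpace ℝ (Fin 3)) l) ≠ ⊤ :=
        ENNReal.mul_ne_top ENNReal.ofReal_ne_top measure_closedBall_lt_top.ne
      rw [integral_eq_lintegral_of_nonneg_ae (ae_of_all _ fun x => abs_nonneg (J x))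
        hJm.abs.aestronglyMeasurable]
      calc (∫⁻ x in Ω ∩ {x | ‖u x‖ ≤ l}, ENNReal.ofReal |J x|).toReal
          ≤ (ENNReal.ofReal N * volume (closedBall (0 : EuclideanSpace ℝ (Fin 3)) l)).toReal :=
            ENNReal.toReal_mono hfin hvol
        _ = N * (volume (closedBall (0 : EuclideanSpace ℝ (Fin 3)) l)).toReal := by
            rw [ENNReal.toReal_mul, ENNReal.toReal_ofReal hN]
    rw [h3, h4] at h2
    calc ∫ x in B ∩ tame, |P x| ≤ ∫ x in B ∩ tame, K * |J x| := h1
      _ = K * ∫ x in Ω ∩ {x | ‖u x‖ ≤ l}, |J x| := h2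
      _ ≤ K * (N * (volume (closedBall (0 : EuclideanSpace ℝ (Fin 3)) l)).toReal) :=
          mul_le_mul_of_nonneg_left h5 hK
      _ = K * N * (volume (closedBall (0 : EuclideanSpace ℝ (Fin 3)) l)).toReal := by ring
  -- ### the fold part
  have hfold_le : ∫ x in B \ tame, |P x| ≤ φ := by
    rw [hfold_eq]
    exact hfold
  calc ∫ x in B, |P x| = (∫ x in B ∩ tame, |P x|) + ∫ x in B \ tame, |P x| := hsplit.symm
    _ ≤ K * N * (volume (closedBall (0 : EuclideanSpace ℝ (Fin 3)) l)).toReal + φ :=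
        add_le_add htame_le hfold_le

/-! ## The transfer to the crux -/

/-- **`SlowClassProduction` from a tame hodograph and a fold-collar budget at singular points**
(transfer `C⁺ ⟹ crux` of the crux idea `jacobian-volume-multiplicity`, at the germ level of line
`near_field`).  Suppose that for every maximal smooth solution `(u,p)` of unforced Navier–Stokes
with lifespan `T`, Leray–Hopf on `[0,T]` from a rapidly decaying datum, every level `l > 0` and
every point `x₀` that is singular at `T` and `l`-slow-accumulating, there are a germ size `ρ > 0`
and functions `K, N, φ` on the last slices `s ∈ [T − ρ, T)` with `K, N ≥ 0`,
`K · N ∈ L¹(T − ρ, T)` (TAME HODOGRAPH: every slow value `‖v‖ ≤ l` is covered at most `N(s)` times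
by the tame regular slow points `{dist x x₀ < ρ, det ∇u ≠ 0, |P| ≤ K(s) |det ∇u|}` of the slice)
and `φ ∈ L¹(T − ρ, T)` (FOLD-COLLAR BUDGET: `∫ |P(s,·)| ≤ φ(s)` over the fold part
`{‖u‖ ≤ l, dist x x₀ < ρ, K(s)|det ∇u| < |P|}`).  Then `SlowClassProduction` holds: each slice costs
`≤ K(s) N(s) vol(B̄_l) + φ(s)` (`sliceBound_of_tame_of_fold`), an `L¹` rate, and
`slowClassProduction_of_singularSliceBound` concludes.  Both hypotheses are scale-invariant counts;
bounding them along the flow is the open residue. [cite: EvansGariepy2015, Thm. 3.8 (PDF p. 76)] -/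
theorem slowClassProduction_of_tameHodograph :
    (∀ (ν T : ℝ), 0 < ν → 0 < T →
      ∀ (u : ℝ → EuclideanSpace ℝ (Fin 3) → EuclideanSpace ℝ (Fin 3))
        (p : ℝ → EuclideanSpace ℝ (Fin 3) → ℝ),
        Literature.Analysis.FluidPDE.IsMaximalSmoothSolution ν 0 u p T →
        Literature.Analysis.FluidPDE.IsLerayHopfOn T ν 0 (u 0) u →
        Literature.Analysis.FluidPDE.HasRapidSpatialDecay (u 0) →
        ∀ l : ℝ, 0 < l → ∀ x₀ : EuclideanSpace ℝ (Fin 3),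
          (∀ r : ℝ, 0 < r → r ^ 2 < T →
            eLpNorm (Function.uncurry u) ⊤ (MeasureTheory.volume.restrict
              (Literature.Analysis.FluidPDE.parabolicCylinder r ((T : ℝ), x₀))) = ⊤) →
          (∀ ρ : ℝ, 0 < ρ → ∃ t ∈ Set.Ico 0 T,
            ({z : ℝ × EuclideanSpace ℝ (Fin 3) | z.1 ∈ Set.Ioo 0 t ∧ ‖u z.1 z.2‖ ≤ l} ∩
              {z : ℝ × EuclideanSpace ℝ (Fin 3) | T - ρ ≤ z.1 ∧ dist z.2 x₀ < ρ}).Nonempty) →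
          ∃ ρ : ℝ, 0 < ρ ∧ ∃ K N φ : ℝ → ℝ,
            MeasureTheory.IntegrableOn (fun s => K s * N s) (Set.Ioo (T - ρ) T) ∧
            MeasureTheory.IntegrableOn φ (Set.Ioo (T - ρ) T) ∧
            ∀ s ∈ Set.Ico (T - ρ) T, 0 ≤ K s ∧ 0 ≤ N s ∧
              (∀ v : EuclideanSpace ℝ (Fin 3), ‖v‖ ≤ l →
                ((u s ⁻¹' {v} ∩ {x : EuclideanSpace ℝ (Fin 3) | dist x x₀ < ρ ∧
                  (fderiv ℝ (u s) x).det ≠ 0 ∧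
                  |inner ℝ (Literature.Analysis.FluidPDE.curl (u s) x) (fderiv ℝ (u s) x
                    (Literature.Analysis.FluidPDE.curl (u s) x))| ≤
                    K s * |(fderiv ℝ (u s) x).det|}).encard : ℝ≥0∞) ≤ ENNReal.ofReal (N s)) ∧
              ∫ x in {x : EuclideanSpace ℝ (Fin 3) | ‖u s x‖ ≤ l ∧ dist x x₀ < ρ ∧
                  K s * |(fderiv ℝ (u s) x).det| <
                    |inner ℝ (Literature.Analysis.FluidPDE.curl (u s) x)
                      (fderiv ℝ (u s) x (Literature.Analysis.FluidPDE.curl (u s) x))|},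
                |inner ℝ (Literature.Analysis.FluidPDE.curl (u s) x)
                  (fderiv ℝ (u s) x (Literature.Analysis.FluidPDE.curl (u s) x))| ≤ φ s) →
    Summit.NavierStokesRegularity.NavierStokesRegularity.Theses.HodographBetchov.SlowClassProduction := by
  intro htame
  refine slowClassProduction_of_singularSliceBound ?_
  intro ν T hν hT u p hmax hLH hdec l hl x₀ hsing hacc
  obtain ⟨ρ, hρ, K, N, φ, hKN, hφ, hs⟩ := htame ν T hν hT u p hmax hLH hdec l hl x₀ hsing hacc
  set V : ℝ := (volume (closedBall (0 : EuclideanSpace ℝ (Fin 3)) l)).toReal with hV_def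
  -- shrink the germ so that its slices are slices of the solution (`T - ρ' ≥ 0`)
  set ρ' : ℝ := min ρ T with hρ'_def
  have hρ'ρ : ρ' ≤ ρ := min_le_left _ _
  have hρ'0 : 0 < ρ' := lt_min hρ hT
  have hsub : Set.Ioo (T - ρ') T ⊆ Set.Ioo (T - ρ) T := fun s hs => ⟨by linarith [hs.1], hs.2⟩
  have hg : MeasureTheory.IntegrableOn (fun s => K s * N s * V + φ s) (Set.Ioo (T - ρ) T) :=
    (hKN.mul_const V).add hφ
  refine ⟨ρ', hρ'0, fun s => K s * N s * V + φ s, hg.mono_set hsub, fun s hs' => ?_⟩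
  have hsρ : s ∈ Set.Ico (T - ρ) T := ⟨by linarith [hs'.1], hs'.2⟩
  obtain ⟨hK0, hN0, hmult, hfold⟩ := hs s hsρ
  have hs0T : s ∈ Set.Ico 0 T := ⟨by linarith [hs'.1, min_le_right ρ T], hs'.2⟩
  have hu1 : ContDiff ℝ 1 (u s) :=
    (hmax.isClassicalNSSolutionOn.contDiff_velocity hs0T).of_le (by norm_cast)
  obtain ⟨hint, hle⟩ := sliceBound_of_tame_of_fold hu1 hK0 hN0 hmult hfold
  have hsubB : {x : EuclideanSpace ℝ (Fin 3) | ‖u s x‖ ≤ l ∧ dist x x₀ < ρ'} ⊆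
      {x : EuclideanSpace ℝ (Fin 3) | ‖u s x‖ ≤ l ∧ dist x x₀ < ρ} :=
    fun x hx => ⟨hx.1, lt_of_lt_of_le hx.2 hρ'ρ⟩
  refine ⟨hint.mono_set hsubB, ?_⟩
  calc ∫ x in {x : EuclideanSpace ℝ (Fin 3) | ‖u s x‖ ≤ l ∧ dist x x₀ < ρ'},
        |inner ℝ (Literature.Analysis.FluidPDE.curl (u s) x)
          (fderiv ℝ (u s) x (Literature.Analysis.FluidPDE.curl (u s) x))|
      ≤ ∫ x in {x : EuclideanSpace ℝ (Fin 3) | ‖u s x‖ ≤ l ∧ dist x x₀ < ρ},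
          |inner ℝ (Literature.Analysis.FluidPDE.curl (u s) x)
            (fderiv ℝ (u s) x (Literature.Analysis.FluidPDE.curl (u s) x))| :=
        setIntegral_mono_set hint.abs (ae_of_all _ fun x => abs_nonneg _) hsubB.eventuallyLE
    _ ≤ K s * N s * V + φ s := hle

end Summit.NavierStokesRegularity.NavierStokesRegularity.Theorems.SlowClassProduction.NearField

end
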